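import Summits.QuantumFields.YangMills.Theorems.BalabanUVNodesN12WindowGradedLetters
import Summits.QuantumFields.YangMills.Theorems.BalabanUVNodesN12RootTransporterBjLocalB
import Summits.QuantumFields.YangMills.Theorems.BalabanUVNodesN12BjRootChainsLam
import HarnessLib

/-!
# BalabanUVNodes ∕ N12 — THE ROOT TRANSPORTER OF ONE WINDOW BOND WITH A `k`-UNIFORM LETTER, AT PRINT's DATUM `Λ(Z) = lamBondsSeq (maxDomT ν.M₁ Z) k` ([Balaban1984PropagatorsII] (2.3)): dag-n12-w6's
# `…N12WindowGradedLetters.rootTransporter_window` RE-KEYED — (CENTRE)ᴸᵃᵐ, the minimiser and the local datum letter on PRINT members, the bond asked to TOUCH `Ω₁(Z)` only (crossing bonds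
# included, LOCATED-2); the chain through print members (this seat's `…N12BjRootChainsLam.exists_rootChain_lamBondsSeq_graded_touching`), the window-near sub-family as a BOND sub-datum `𝔅′ ⊆ Λ(Z)`, the local transporter dag-n12-d's `…RootTransporterBjLocalB` — the rest (graded budgets, §1–§3 of the parent)
# by name — O1 module (11a) of the gauge-letter chain (dag-n12-d CEDE ∕ dag-lead WORDS 426∕427∕430, pub-ymgap INBOX 2026-08-30)

[Balaban1984PropagatorsII] = «[II]», (2.3) p. 224; [Balaban1985Variational] = «[15]», (2)–(4) p. 278, Thm 1 (8) p. 279, (16)–(18) p. 280; [Balaban1985RegularSpaces] (1.7) p. 77, (1.19) p. 79;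
[Balaban1985Averaging] (19)–(20) p. 21, Prop. 2 (52)–(53) p. 26; [Balaban1988Convergent] = «[III]», p. 255, (2.2) p. 255, (2.11)–(2.13) pp. 256–257, (2.16) p. 257; [Balaban1987RG1], (0.1) p. 251;
[Balaban1989LargeFieldII], p. 357.

Cell `pub-ymgap` (HUMAN RULINGS D-0062 ∕ D-0149), lane `pub-ymgap-dag-n12-c` g37 (R134 seat (a), N12 = [B15], s1, lane owner); `--kind proof --supports` K1⁹ `stmt-QuantumFields-27364` `--as helper`;
count-neutral.  THEOREMS ONLY (0 `def`, 0 `instance`, 0 `sorry`); the parent's `rootTransporter_window` with its proof text (tree bytes, `work/gen_window_lam.py`) and the substitutions listed in the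
theorem's docstring; the parent's `iteratedPlaqLetter_window` ∕ `towerBudget_uniform` ∕ `stokesTerm_uniform_le` (datum-free) and dag-n12-w6's `…N12WindowNearRegionGeometry` REUSED by name.
DECL MAP (old → new): `N12WindowGradedLetters.rootTransporter_window ↦ N12WindowGradedLettersLam.rootTransporter_window_lamBondsSeq` (hypotheses `hcentre ↦ hroot` — the simple (CENTRE)ᴸᵃᵐ
clause of `…N12TowerForestLam.exists_towerForest_rooted_lamBondsSeq` —, `hbs ∧ hbt ↦ hb : b₋ ∈ Ω₁(Z) ∨ b₊ ∈ Ω₁(Z)`); the parent's other three theorems unchanged (datum-free, reused).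

WHY.  The window letter reads the (2.12) constraint at the members of the chain (`hmin.2.1`), so at print's datum the chain must consist of PRINT members — `…N12BjRootChainsLam` — and the
window-near sub-family on which the local transporter runs must be a sub-datum of `Λ(Z)`; the reachability bookkeeping (an end of every link is a `Γ`-site reachable from the window within
`ℓ_k + m′L^k + L^k`) is the parent's, read through `Λ_i(Z) ⊆ bondsOf Γ_i^{(i)}`.

HONEST FRAMING.  Lattice bookkeeping and composition by name over landed kernel theorems; the minimiser ([15] Thm 1 ∕ the lane's (E)), its graded plaquette letter, the region datum, the window
rows and the numerics stay HYPOTHESES; constants `C(d, L)`, uniform in `k` and in the volume, NOT print's `O(1)` bookkeeping verbatim; nothing of Bałaban's asserted or refuted beyond the cited tree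
theorems; count-neutral helper (`--supports 27364`); N12 NOT discharged; K0⁷∕K1⁹ NOT closed; counts of record unmoved (typed 28∕28 · discharged 8∕27); one finite 𝕋⁴ programme at fixed ε — R4
closes the conditional rung `BalabanLadder.UV` only; the Yang–Mills mass gap (Clay) is NOT proved by any of this; nothing continuum ∕ ℝ⁴ ∕ OS.
-/

noncomputable section

open scoped Matrix.Norms.L2Operator BigOperators

namespace Summit.QuantumFields.YangMills.BalabanUVNodes.N12WindowGradedLettersLam

open Literature.MathematicalPhysics.QuantumFieldTheory.Balaban1983to89
open T4Continuum GaugeField B15DeterminingSets B15DeterminingSetsB BlockAveraging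
open T4CubeChartGnomonic (SU2)
open B16Sect1Backgrounds (toMS)
open T4AxialGaugeSmallField (boxPlaqs castSite)
open B14.Eq213MaximalDomains (side)
open B14.Eq213DetSet (Bj maxDomT maxDomT_antitone dist_maxDomT)
open B14.Eq22Determines (blockIter)
open B14DomainGeom (Within Pt)
open B15Eq112TorusCover (cover lift cover_lift cover_apply)
open B5Eq118OneStroke (iterBlockOf)
open B8Eq17ClassAkV1 (plaqsOf)
open ExpMeanLog (expMeanLogSU deltaSU)
open Literature.MathematicalPhysics.QuantumFieldTheory.BalabanImbrieJaffe1984to88.BIJ85Eq453GaugeField (qsstarGIter0)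
open LatticeWordCountBox (netDisp_le_count_true neg_count_false_le_netDisp walkEnd_castSite)
open Summit.QuantumFields.YangMills.Theorems.BalabanUVNodesN11LocalIteratedAveraging (plaqSmallOn_iter_avOfRecord_of_boxClosed)
open Summit.QuantumFields.YangMills.BalabanUVNodes.N12FlatHndRecordLetters (hcov_Bj)
open Summit.QuantumFields.YangMills.BalabanUVNodes.N12RootTransporterBj (theta_mono_of_nonneg)
open Summit.QuantumFields.YangMills.BalabanUVNodes.N12RootTransporterBjLocalB (transporter_of_links_local)
open Summit.QuantumFields.YangMills.BalabanUVNodes.N12BjRootChainsLam (exists_rootChain_lamBondsSeq_graded_touching)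
open Summit.QuantumFields.YangMills.BalabanUVNodes.N12WindowNearRegionGeometry (base_subset_topSeq_window exists_word_endpoints)
open Summit.QuantumFields.YangMills.BalabanUVNodes.N12WindowGradedLetters (iteratedPlaqLetter_window towerBudget_uniform stokesTerm_uniform_le)

/-! ## The root transporter of one window bond at print's datum -/

/-- ★★★ **[PRINT's DATUM `Λ(Z)`: (CENTRE)ᴸᵃᵐ clause `root z = ι_J(B^J z)` (`hroot`), `hmin ↦ IsMinimizerB … (lamBondsSeq …)` and the local datum letter `hWj` read on PRINT members; the bond is asked to TOUCH `Ω₁(Z)` only (`hb`: interior AND crossing bonds — LOCATED-2; on a crossing bond the chain runs through the OUTWARD connector, `…N12BjRootChainsLam.exists_rootChain_lamBondsSeq_graded_touching`); the window-near sub-family is a BOND datum `𝔅′ ⊆ Λ(Z)`, dag-n12-d's `…RootTransporterBjLocalB.transporter_of_links_local` runs on it.]** ★★ **THE ROOT TRANSPORTER OF ONE WINDOW BOND, `k`-UNIFORM.**  For a fine bond `b` touching `Ω₁(Z)` whose source lies in the window `X` (within `D₀` fine steps of `Ω_k`), the root chain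
`root b₋ ⇝ root b₊` (between the `Γ`-centres of the two ends) carries a transporter `𝒰_{U₀}(chain)·g⁻¹` with `dist1 ≤ m′·24·(((d+2)L)²∕4)·ε` — INDEPENDENT OF `k` — and `dist1 g ≤ m′·ρn`,
from: ONE class ∕ [15]-Thm-1 letter at level `k−1`, the (2.12) datum letter at the members reachable from `root b₋` within `m′L^k`, and the collar numerics `hfit`.  Inside: the chain's members
all lie within `ℓ_k + m′L^k + L^k` of the window, so dag-n12-w3's `transporter_of_links_local` runs on the WINDOW-NEAR sub-family of `𝐁_k(Z)` with §4's geometrically graded plaquette letter,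
and the tower budgets close uniformly (`towerBudget_uniform`).
[cite: Balaban1985Variational, (3)–(4) p.278, (16)–(18) p.280; Balaban1985Averaging, (19)–(20) p.21, Prop. 1 (24) p.22, Prop. 2 (52)–(53) p.26; Balaban1988Convergent, (2.12)–(2.13) pp.256–257, (2.16) p.257] -/
theorem rootTransporter_window_lamBondsSeq {F : T4Family} (ν : Node00.Stage7Numerics) (Kt : ℕ) {k : ℕ} (hk1 : 1 ≤ k) (hk : k ≤ (F.P Kt).m + (F.P Kt).K)
    (hM2 : 2 ≤ ν.M₁) (hdiv : side (F.P Kt).L ν.M₁ k ∣ (F.P Kt).sitesPerDir 0) (Z : Set (Site (F.P Kt) 0))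
    (root : Site (F.P Kt) 0 → Site (F.P Kt) 0)
    (hroot : ∀ (z : Site (F.P Kt) 0) (J : ℕ), iterBlockOf J z ∈ (Bj ν.M₁ Z k : DetSet (F.P Kt)) J → root z = embIter J (iterBlockOf J z))
    {reg : Set (GaugeField (F.P Kt) 0 SU2)} (W : GaugeField (F.P Kt) k SU2) {U₀ : GaugeField (F.P Kt) 0 SU2}
    (hmin : IsMinimizerB (Node00.avOfRecord F 2 Kt) reg (lamBondsSeq (maxDomT ν.M₁ Z) k) (avgFamily (Node00.avOfRecord F 2 Kt) (qsstarGIter0 k W)) U₀)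
    -- ONE graded plaquette letter at level `k − 1`, Prop. 2-small
    {ε : ℝ} (hεpos : 0 < ε)
    (hUk : PlaqSmallOn (plaqsOf (Node00.topSeq (Node00.suppDomOfRecord F ν Kt (maxDomT ν.M₁ Z)) (maxDomT ν.M₁ Z) (k - 1))) (ε * (F.P Kt).eta (k - 1) ^ 2) U₀)
    (hα3 : (143 * (((((F.P Kt).d + 4 : ℕ) : ℝ)) ^ 2 / 4) ^ 2) * (ε * (F.P Kt).L ^ 2) ≤ 1 / 3)
    (hα2 : 2 * (ε * (F.P Kt).L ^ 2) ≤ 2 * deltaSU (Fin 2) / ((((F.P Kt).d + 4) * (F.P Kt).L : ℕ) : ℝ) ^ 2)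
    (haN : (((((F.P Kt).d + 2) * (F.P Kt).L : ℕ) : ℝ) ^ 2 / 4) * (2 * (ε * (F.P Kt).L ^ 2)) < deltaSU (Fin 2))
    -- the window, within `D₀` of `Ω_k`, and the collar numerics
    (X : Set (Site (F.P Kt) 0)) {D₀ : ℕ} (hXΩ : ∀ x ∈ X, ∃ x₀ ∈ maxDomT ν.M₁ Z k, ∃ w₀ : List (Letter (F.P Kt).d), w₀.length ≤ D₀ ∧ walkEnd x₀ w₀ = x)
    (hfit : D₀ + ((∑ i ∈ Finset.range (k + 1), ((F.P Kt).d * (((F.P Kt).L ^ i - 1) / 2) + 1)) + (3 * ((F.P Kt).d * (((F.P Kt).L - 1) / 2)) + 5) * (F.P Kt).L ^ k + (F.P Kt).L ^ k) +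
      (F.P Kt).L ^ k + (3 * (F.P Kt).L ^ k + (((F.P Kt).d + 4) * (F.P Kt).L + 2) * ∑ l ∈ Finset.Ico 0 k, (F.P Kt).L ^ l) + 1 ≤ (F.P Kt).L ^ (k - 1) * ν.M₁)
    {ρn : ℝ} (hρn : 0 ≤ ρn)
    -- the bond: source in the window, AN end in `Ω₁(Z)` (crossing bonds included), its root reached within `ℓ_k`
    (b : PBond (F.P Kt) 0) (hbX : b.src ∈ X) (hb : b.src ∈ maxDomT ν.M₁ Z 1 ∨ b.tgt ∈ maxDomT ν.M₁ Z 1)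
    {wr : List (Letter (F.P Kt).d)} (hwr : wr.length ≤ ∑ i ∈ Finset.range (k + 1), ((F.P Kt).d * (((F.P Kt).L ^ i - 1) / 2) + 1)) (hwre : walkEnd b.src wr = root b.src)
    -- the datum letter at the members reachable from `root b₋` within `m′L^k`
    (hWj : ∀ i ≤ k, ∀ c ∈ lamBondsSeq (maxDomT ν.M₁ Z) k i,
      (∃ w : List (Letter (F.P Kt).d), w.length ≤ (3 * ((F.P Kt).d * (((F.P Kt).L - 1) / 2)) + 5) * (F.P Kt).L ^ k ∧
        (walkEnd (root b.src) w = embIter i c.src ∨ walkEnd (root b.src) w = embIter i c.tgt)) →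
      dist1 (avgFamily (Node00.avOfRecord F 2 Kt) (qsstarGIter0 k W) i c) ≤ ρn)
    {J : ℕ} (hJ : iterBlockOf J b.src ∈ (Bj ν.M₁ Z k : DetSet (F.P Kt)) J) :
    ∃ (Ωw : List (Letter (F.P Kt).d)) (g : SU2), walkEnd (root b.src) Ωw = root b.tgt ∧
      Ωw.length ≤ (3 * ((F.P Kt).d * (((F.P Kt).L - 1) / 2)) + 5) * (F.P Kt).L ^ min (J + 1) k ∧
      dist1 (holAt U₀ (walk (root b.src) Ωw) * g⁻¹) ≤ ((3 * ((F.P Kt).d * (((F.P Kt).L - 1) / 2)) + 5 : ℕ) : ℝ) * (24 * ((((((F.P Kt).d + 2) * (F.P Kt).L : ℕ) : ℝ) ^ 2 / 4) * ε)) ∧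
      dist1 g ≤ ((3 * ((F.P Kt).d * (((F.P Kt).L - 1) / 2)) + 5 : ℕ) : ℝ) * ρn := by
  classical
  have hM : 1 ≤ ν.M₁ := by omega
  have hL2 : 2 ≤ (F.P Kt).L := (F.P Kt).hL.2
  have hL1 : (1 : ℝ) ≤ (F.P Kt).L := by exact_mod_cast (F.P Kt).L_pos
  have hL0 : (0 : ℝ) < (F.P Kt).L := by linarith
  -- ### the graded tower budgets
  set κ : ℕ → ℝ := fun j => 6 * ((((((F.P Kt).d + 2) * (F.P Kt).L : ℕ) : ℝ) ^ 2 / 4) * (2 * (ε * ((F.P Kt).L : ℝ) ^ 2) * (((F.P Kt).L : ℝ) ^ j * (F.P Kt).eta k) ^ 2)) with hκ_def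
  set θ : ℕ → ℝ := fun j => 6 * ((((((F.P Kt).d + 2) * (F.P Kt).L : ℕ) : ℝ) ^ 2 / 4) * (2 * (ε * ((F.P Kt).L : ℝ) ^ 2))) * (F.P Kt).eta k ^ 2 / (F.P Kt).L * ((F.P Kt).L : ℝ) ^ j *
    ∑ i ∈ Finset.range j, ((F.P Kt).L : ℝ) ^ i with hθ_def
  obtain ⟨hθ0, hθ, hθk⟩ := towerBudget_uniform (P := F.P Kt) hL2 hk1 hεpos.le
  have hκ0 : ∀ j, 0 ≤ κ j := fun j => by rw [hκ_def]; unfold Params.eta; positivity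
  have hθmono : ∀ i j, i ≤ j → θ i ≤ θ j := fun i j hij => (theta_mono_of_nonneg κ θ hθ0 hκ0 hθ hij).2
  -- ### the window-near sub-family of `𝐁_k(Z)`
  set R₃ : ℕ := (∑ i ∈ Finset.range (k + 1), ((F.P Kt).d * (((F.P Kt).L ^ i - 1) / 2) + 1)) + (3 * ((F.P Kt).d * (((F.P Kt).L - 1) / 2)) + 5) * (F.P Kt).L ^ k + (F.P Kt).L ^ k with hR₃
  let 𝔅' : BDetSet (F.P Kt) := fun i => {c | c ∈ lamBondsSeq (maxDomT ν.M₁ Z) k i ∧ ∃ y : Site (F.P Kt) i, (y = c.src ∨ y = c.tgt) ∧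
    y ∈ (Bj ν.M₁ Z k : DetSet (F.P Kt)) i ∧ ∃ x ∈ X, ∃ w : List (Letter (F.P Kt).d), w.length ≤ R₃ ∧ walkEnd x w = embIter i y}
  -- ### the graded corr letter on the sub-family (§4 + [Balaban1985Averaging] Prop. 1)
  have hκ' : ∀ i ≤ k, ∀ c ∈ 𝔅' i, ∀ i' < i, ∀ c' : PBond (F.P Kt) (i' + 1), c'.dir = c.dir →
      (∃ t < (F.P Kt).L ^ i, embIter (i' + 1) c'.src = (fun z : Site (F.P Kt) 0 => z.shift c.dir)^[t] (embIter i c.src)) →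
      dist1 (corr (expMeanLogSU (n := Fin 2)) (Averaging.iter (fun i => blockAvg (P := F.P Kt) (j := i) (expMeanLogSU (n := Fin 2))) i' U₀) c') ≤ κ i' := by
    intro i hi c hc i' hi' c' hdir hs
    obtain ⟨-, y, hy, -, x, hxX, w, hwl, hwe⟩ := hc
    obtain ⟨x₀, hx₀, w₀, hw₀l, hw₀e⟩ := hXΩ x hxX
    have hfit_i : D₀ + R₃ + (F.P Kt).L ^ i + (3 * (F.P Kt).L ^ i + (((F.P Kt).d + 4) * (F.P Kt).L + 2) * ∑ l ∈ Finset.Ico 0 i, (F.P Kt).L ^ l) + 1 ≤ (F.P Kt).L ^ (k - 1) * ν.M₁ := by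
      have h1 : (F.P Kt).L ^ i ≤ (F.P Kt).L ^ k := Nat.pow_le_pow_right (F.P Kt).L_pos hi
      have h2 : ∑ l ∈ Finset.Ico 0 i, (F.P Kt).L ^ l ≤ ∑ l ∈ Finset.Ico 0 k, (F.P Kt).L ^ l :=
        Finset.sum_le_sum_of_subset (Finset.Ico_subset_Ico_right hi)
      have h3 := Nat.mul_le_mul_left (((F.P Kt).d + 4) * (F.P Kt).L + 2) h2
      have h4 := hfit
      rw [hR₃]
      omega
    have ha := iteratedPlaqLetter_window ν Kt hk1 hk hM hdiv Z hεpos hUk hα3 hα2 (i := i) (by omega) hi c hy hx₀ hw₀e hwe hw₀l hwl hfit_i i' hi' c' hdir hs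
    have hratio : (((F.P Kt).L : ℝ) ^ i' * (F.P Kt).eta k) ^ 2 ≤ 1 := by
      have h1 : ((F.P Kt).L : ℝ) ^ i' * (F.P Kt).eta k ≤ 1 := by
        unfold Params.eta
        rw [inv_pow, ← div_eq_mul_inv, div_le_one (pow_pos hL0 _)]
        exact pow_le_pow_right₀ hL1 (by omega)
      have h0 : 0 ≤ ((F.P Kt).L : ℝ) ^ i' * (F.P Kt).eta k := by unfold Params.eta; positivity
      nlinarith
    have ha0 : 0 ≤ 2 * (ε * ((F.P Kt).L : ℝ) ^ 2) * (((F.P Kt).L : ℝ) ^ i' * (F.P Kt).eta k) ^ 2 := by positivity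
    have haN' : (((((F.P Kt).d + 2) * (F.P Kt).L : ℕ) : ℝ) ^ 2 / 4) * (2 * (ε * ((F.P Kt).L : ℝ) ^ 2) * (((F.P Kt).L : ℝ) ^ i' * (F.P Kt).eta k) ^ 2) < deltaSU (Fin 2) := by
      refine lt_of_le_of_lt (mul_le_mul_of_nonneg_left ?_ (by positivity)) haN
      have h2 : 0 ≤ 2 * (ε * ((F.P Kt).L : ℝ) ^ 2) := by positivity
      nlinarith
    exact BlockAveragingPlaquetteBoundLocal.dist1_corr_le_local ha0 (by omega) c' ha haN'
  -- ### the datum letter on the sub-family, relative to `root b₋` (the (2.12) constraint)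
  have hδ₁' : ∀ i ≤ k, ∀ c ∈ 𝔅' i,
      (∃ w : List (Letter (F.P Kt).d), w.length ≤ (3 * ((F.P Kt).d * (((F.P Kt).L - 1) / 2)) + 5) * (F.P Kt).L ^ k ∧
        (walkEnd (root b.src) w = embIter i c.src ∨ walkEnd (root b.src) w = embIter i c.tgt)) →
      dist1 (Averaging.iter (fun i => blockAvg (P := F.P Kt) (j := i) (expMeanLogSU (n := Fin 2))) i U₀ c) ≤ ρn := fun i hi c hc hw => by
    have hc' : c ∈ lamBondsSeq (maxDomT ν.M₁ Z) k i := hc.1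
    have hagree : avgFamily (Node00.avOfRecord F 2 Kt) U₀ i c = avgFamily (Node00.avOfRecord F 2 Kt) (qsstarGIter0 k W) i c := hmin.2.1 i c hc'
    show dist1 (avgFamily (Node00.avOfRecord F 2 Kt) U₀ i c) ≤ ρn
    rw [hagree]
    exact hWj i hi c hc' hw
  -- ### the graded root chain of `b`; its links are members of the sub-family
  obtain ⟨J', -, hJ'⟩ := hcov_Bj hM hk1 hk hdiv (Z := Z) b.tgt
  obtain ⟨-, links, hlen0, hmem0, hend, hcons⟩ := exists_rootChain_lamBondsSeq_graded_touching hk hk1 hM2 hdiv b hb hJ hJ'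
  have hrs : root b.src = embIter J (iterBlockOf J b.src) := hroot b.src J hJ
  have hrt : root b.tgt = embIter J' (iterBlockOf J' b.tgt) := hroot b.tgt J' hJ'
  rw [← hrs, ← hrt] at hend
  rw [← hrs] at hcons
  have hlen : links.length ≤ 3 * ((F.P Kt).d * (((F.P Kt).L - 1) / 2)) + 5 := hlen0.trans (by omega)
  have hmem : ∀ l ∈ links, l.1 ≤ k ∧ l.2.1 ∈ lamBondsSeq (maxDomT ν.M₁ Z) k l.1 := fun l hl => ⟨(hmem0 l hl).2.2.1, (hmem0 l hl).2.2.2⟩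
  have hgrade : ∀ l ∈ links, l.1 ≤ J + 1 ∧ l.1 ≤ J' + 1 := fun l hl => ⟨(hmem0 l hl).1, (hmem0 l hl).2.1⟩
  have hmem' : ∀ l ∈ links, l.1 ≤ k ∧ l.2.1 ∈ 𝔅' l.1 := by
    intro l hl
    obtain ⟨hlk, hlB⟩ := hmem l hl
    refine ⟨hlk, ?_⟩
    obtain ⟨s, t, hst⟩ := List.append_of_mem hl
    have hcst := hcons s t l hst
    -- the prefix word from `root b₋` to an end centre `e` of the link
    have hlenS : ((s.map fun l => List.replicate ((F.P Kt).L ^ l.1) (l.2.1.dir, l.2.2)).flatten).length ≤ (3 * ((F.P Kt).d * (((F.P Kt).L - 1) / 2)) + 5) * (F.P Kt).L ^ k := by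
      refine le_trans (N12BlockChains.length_flatten_le_of_forall_le _ s fun l' hl' => ?_) (le_trans (Nat.mul_le_mul_right _ ?_) (Nat.mul_le_mul_right _ hlen))
      · rw [List.length_replicate]; exact Nat.pow_le_pow_right (F.P Kt).L_pos (hmem l' (by rw [hst]; simp [hl'])).1
      · have := congrArg List.length hst; simp only [List.length_append, List.length_cons] at this; omega
    have hreach : ∃ e : Site (F.P Kt) l.1, (e = l.2.1.src ∨ e = l.2.1.tgt) ∧
        walkEnd (root b.src) ((s.map fun l => List.replicate ((F.P Kt).L ^ l.1) (l.2.1.dir, l.2.2)).flatten) = embIter l.1 e := by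
      cases h2 : l.2.2
      · exact ⟨_, Or.inr rfl, hcst.2 h2⟩
      · exact ⟨_, Or.inl rfl, hcst.1 h2⟩
    obtain ⟨e, he, hwe⟩ := hreach
    -- the end of the link that belongs to `𝐁_k(Z)`
    have hyex : ∃ y : Site (F.P Kt) l.1, (y = l.2.1.src ∨ y = l.2.1.tgt) ∧ y ∈ (Bj ν.M₁ Z k : DetSet (F.P Kt)) l.1 := by
      rcases lamBondsSeq_subset_bondsOf_genSet (maxDomT ν.M₁ Z) k l.1 hlB with h | h
      · exact ⟨_, Or.inl rfl, h⟩
      · exact ⟨_, Or.inr rfl, h⟩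
    obtain ⟨y, hy, hyB⟩ := hyex
    obtain ⟨u, hul, hue⟩ := exists_word_endpoints l.2.1 he hy
    refine ⟨hlB, y, hy, hyB, b.src, hbX, wr ++ ((s.map fun l => List.replicate ((F.P Kt).L ^ l.1) (l.2.1.dir, l.2.2)).flatten) ++ u, ?_, ?_⟩
    · rw [List.length_append, List.length_append, hR₃]
      have hu' : u.length ≤ (F.P Kt).L ^ k := hul.trans (Nat.pow_le_pow_right (F.P Kt).L_pos hlk)
      omega
    · rw [walkEnd_append, walkEnd_append, hwre, hwe, hue]
  -- ### the transporter of the chain (dag-n12-w3), with the window-near sub-family and the graded budgets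
  have hR : links.length * (F.P Kt).L ^ min (J + 1) k ≤ (3 * ((F.P Kt).d * (((F.P Kt).L - 1) / 2)) + 5) * (F.P Kt).L ^ k :=
    Nat.mul_le_mul hlen (Nat.pow_le_pow_right (F.P Kt).L_pos (min_le_right _ _))
  obtain ⟨g, hH, hg, hl⟩ := transporter_of_links_local (expMeanLogSU (n := Fin 2)) U₀ κ θ hθ0 hθ
    (fun i hi => hθmono i _ hi) 𝔅' hκ' (root b.src) links hmem' (fun l hl => le_min (hgrade l hl).1 (hmem l hl).1) hcons hR hδ₁'
  have hθN : θ (min (J + 1) k) ≤ 24 * ((((((F.P Kt).d + 2) * (F.P Kt).L : ℕ) : ℝ) ^ 2 / 4) * ε) := (hθmono _ _ (min_le_right _ _)).trans hθk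
  have hθN0 : 0 ≤ θ (min (J + 1) k) := hθ0.trans (hθmono 0 _ (Nat.zero_le _))
  have hlenR : (links.length : ℝ) ≤ ((3 * ((F.P Kt).d * (((F.P Kt).L - 1) / 2)) + 5 : ℕ) : ℝ) := by exact_mod_cast hlen
  have hm0 : (0 : ℝ) ≤ ((3 * ((F.P Kt).d * (((F.P Kt).L - 1) / 2)) + 5 : ℕ) : ℝ) := Nat.cast_nonneg _
  refine ⟨_, g, hend, hl.trans (Nat.mul_le_mul_right _ hlen), hH.trans ?_, hg.trans (mul_le_mul_of_nonneg_right hlenR hρn)⟩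
  calc (links.length : ℝ) * θ (min (J + 1) k) ≤ ((3 * ((F.P Kt).d * (((F.P Kt).L - 1) / 2)) + 5 : ℕ) : ℝ) * θ (min (J + 1) k) :=
        mul_le_mul_of_nonneg_right hlenR hθN0
    _ ≤ ((3 * ((F.P Kt).d * (((F.P Kt).L - 1) / 2)) + 5 : ℕ) : ℝ) * (24 * ((((((F.P Kt).d + 2) * (F.P Kt).L : ℕ) : ℝ) ^ 2 / 4) * ε)) :=
        mul_le_mul_of_nonneg_left hθN hm0

end Summit.QuantumFields.YangMills.BalabanUVNodes.N12WindowGradedLettersLam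

end
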